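import Mathlib
import Literature.Analysis.ValidatedNumerics.PolySignCells
import Summits.Ventures.FusionMHD.Models.KinkEqQ07Sigma013WitnessData
import HarnessLib

/-!
# F3.σ rider of #95 («#95‴ LOWER-013»): kernel sign certificate of `W` (= `U·H(1+r²)³(25+r²)² − R_N`, file `KinkEqQ07Sigma013WitnessData`) on `[1/2, 1]` — one
# `decide +kernel` (`PolySignCells`), split from its twin half to keep every file under the cell's elaboration budget

Seat `gridfusion-sos-6` g5, 2026-08-27; generator `HOME/cert/sos-6/kink/emit_witness_gen.py --wsplit`.  Nothing here is a stability statement.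
[instance data]
-/

noncomputable section

open Literature.Analysis.ValidatedNumerics Literature.Analysis.ValidatedNumerics.ExpPoly

namespace Summit.Ventures.FusionMHD.Models.KinkEqQ07

/-- Kernel check: `W > 0` on `[1/2, 1]`. [instance data] -/
theorem WL_posCellsB013 : Poly.posCells WL013 ((((1 : ℚ) / 2)) :: ([((5 : ℚ) / 8), ((3 : ℚ) / 4), ((7 : ℚ) / 8)] ++ [((1 : ℚ))])) = true := by
  decide +kernel

end Summit.Ventures.FusionMHD.Models.KinkEqQ07

end
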